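import Summits.Ventures.PercRepro.S2DichotomyTools
import Summits.Ventures.PercRepro.S2TailCell
import Summits.Ventures.PercRepro.S2SpanningCount
import Summits.Ventures.PercRepro.S2FlatCountTwo
import Summits.Ventures.PercRepro.S2PhiFifteenFive
import Summits.Ventures.PercRepro.TriangleCapEightI
import Summits.Ventures.PercRepro.S1CoreCapSevenFinal
import Summits.Ventures.PercRepro.S1FiveCircuitBase

/-!
# PercRepro — S2: THE CELL `(15, 10)` OF THE `q = 5` WINDOW BY THE CONCENTRATED TAIL (p7, gen 12; sub-claim S2; the `p = 15` row)

The nested dichotomy on «a set `W` of nullity `k` on `≤ 5 + k` points», `k = 9, …, 4`, with — in the case `k` — the tail's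
spanning term counted BELOW `W` (`S2.ncard_spanning_le_of_nullity`: the complement of a spanning set has `≤ 10` points, at most
`10 − k` of them outside `W`) instead of the kit's `Σ_{j ≤ 10} C(25, j) = 7119516`, through S2TailCell's cell theorem with the
`(U)`-side, the spanning count and the slack `m/1024` chosen case by case (`gencellk.py`, every numeral exact; standard caps
`20 / 174 / 1518`, no coloop split). **`ThmN.c025_core_five_fifteen_ten (M) (hR : ρ(E) = 15) (hn : |E| = 25) (hfree) : RLS M 15 5`**.
Axioms: standard.
-/

open scoped Matroid

namespace PercRepro

namespace ThmN

open Set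

variable {α : Type}

/-- The standard caps at `(15, 10)`: `s₃ ≤ 20` (`TriangleCap.cq3 10`), `s₄ ≤ 174` (`S1.avgBoundSeven 3`, the `Q*(7) = 19` chain), `s₅ ≤ 1518` (`S1.avgChain5b 10`) on every `e`-free core of nullity `10`. -/
theorem caps_fifteen_ten (M : Matroid α) [M.Finite]
    (hd : M.E.encard = M.eRank + ((10 : ℕ) : ℕ∞))
    (hfree : ∀ e ∈ M.E, ∃ A ⊆ M.E \ {e}, e ∉ M.closure A ∧ e ∉ M.closure ((M.E \ {e}) \ A)) :
    {C : Set α | M.IsCircuit C ∧ C.ncard = 3}.ncard ≤ 20 ∧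
      {C : Set α | M.IsCircuit C ∧ C.ncard = 4}.ncard ≤ 174 ∧
        {C : Set α | M.IsCircuit C ∧ C.ncard = 5}.ncard ≤ 1518 := by
  have hs3 := TriangleCap.core_ncard_triangles_le_cq3 M hfree hd
  rw [show TriangleCap.cq3 10 = 20 by decide] at hs3
  have hs4 := S1.ncard_fourCircuits_le_avgBoundSeven 3 M hfree (by convert hd using 2; norm_num)
  rw [show S1.avgBoundSeven 3 = 174 by decide] at hs4
  have hs5 := S1.ncard_fiveCircuits_le_avgChain5b 10 M hfree hd
  rw [show S1.avgChain5b 10 = 1518 by decide] at hs5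
  exact ⟨hs3, hs4, hs5⟩

/-- The tail side of the cell `(15, 10)` on the caps `20 / 174 / 1518` with the spanning count `S` a parameter: the rank-`≤ 5` part
of the kit's tail is exactly `3510681909905 / 5039622 = 696,616.1`, so `1024·(T + S) ≤ m·2^25` whenever `1024·(3510681909905 / 5039622 + S) ≤ m·2^25`. -/
theorem tail_fifteen_ten (S m : ℕ) (h : (1024 : ℚ) * ((3510681909905 / 5039622 : ℚ) + (S : ℚ)) ≤ (m : ℚ) * 2 ^ 25) :
    1024 * ((((15 + 10).choose 4 : ℚ) +
      (∑ j ∈ Finset.range 6, (Nat.choose (min 5 ((10 + 3) / 2 + 1 - 2)) j : ℚ) / (((j + 1) + 3 * (j + 1).choose 2 + 3 * (j + 1).choose 3 + 2 * (j + 1).choose 4 : ℕ) : ℚ)) *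
        ((20 * (15 + 10 - 3).choose 2 + 174 * (15 + 10 - 4) + 1518 : ℕ) : ℚ) +
      ((∑ j ∈ Finset.range 6, (Nat.choose 5 j : ℚ) / (((j + 1) + 3 * (j + 1).choose 2 + 3 * (j + 1).choose 3 + 2 * (j + 1).choose 4 : ℕ) : ℚ)) -
        (∑ j ∈ Finset.range 6, (Nat.choose (min 5 ((10 + 3) / 2 + 1 - 2)) j : ℚ) / (((j + 1) + 3 * (j + 1).choose 2 + 3 * (j + 1).choose 3 + 2 * (j + 1).choose 4 : ℕ) : ℚ))) *
        ((10 : ℕ).choose 5 : ℚ)) +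
      (((15 + 10).choose 3 * 2 ^ 3 + (15 + 10).choose 2 * 2 + (15 + 10) + 1 : ℕ) : ℚ) +
      (((15 + 10).choose 5 : ℚ) + (∑ j ∈ Finset.range (10), (Nat.choose (min 13 ((10 + 6) / 2 + 1 - 2)) j : ℚ) / (((j + 1) + 3 * (j + 1).choose 2 + 3 * (j + 1).choose 3 + 2 * (j + 1).choose 4 : ℕ) : ℚ)) * ((20 * (15 + 10 - 3).choose 3 + 174 * (15 + 10 - 4).choose 2 + 1518 * (15 + 10 - 5) + (10 + 5).choose 6 : ℕ) : ℚ) +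
        ((∑ j ∈ Finset.range (10), (Nat.choose (min 19 (5 + 10) - 6) j : ℚ) / (((j + 1) + 3 * (j + 1).choose 2 + 3 * (j + 1).choose 3 + 2 * (j + 1).choose 4 : ℕ) : ℚ)) - (∑ j ∈ Finset.range (10), (Nat.choose (min 13 ((10 + 6) / 2 + 1 - 2)) j : ℚ) / (((j + 1) + 3 * (j + 1).choose 2 + 3 * (j + 1).choose 3 + 2 * (j + 1).choose 4 : ℕ) : ℚ))) *
        ((min 19 (5 + 10)).choose 6 : ℚ)) +
      (S : ℚ)) ≤ (m : ℚ) * 2 ^ (15 + 10) := by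
  have hsm : (∑ j ∈ Finset.range (10), (Nat.choose (min 13 ((10 + 6) / 2 + 1 - 2)) j : ℚ) / (((j + 1) + 3 * (j + 1).choose 2 + 3 * (j + 1).choose 3 + 2 * (j + 1).choose 4 : ℕ) : ℚ)) = 6418141 / 1184400 := by
    norm_num [Finset.sum_range_succ, Nat.choose]
  have hsg : (∑ j ∈ Finset.range (10), (Nat.choose (min 19 (5 + 10) - 6) j : ℚ) / (((j + 1) + 3 * (j + 1).choose 2 + 3 * (j + 1).choose 3 + 2 * (j + 1).choose 4 : ℕ) : ℚ)) = 295528511 / 27997900 := by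
    norm_num [Finset.sum_range_succ, Nat.choose]
  have hs4m : (∑ j ∈ Finset.range 6, (Nat.choose (min 5 ((10 + 3) / 2 + 1 - 2)) j : ℚ) / (((j + 1) + 3 * (j + 1).choose 2 + 3 * (j + 1).choose 3 + 2 * (j + 1).choose 4 : ℕ) : ℚ)) = 12767 / 4230 := by
    norm_num [Finset.sum_range_succ, Nat.choose]
  have hs4g : (∑ j ∈ Finset.range 6, (Nat.choose 5 j : ℚ) / (((j + 1) + 3 * (j + 1).choose 2 + 3 * (j + 1).choose 3 + 2 * (j + 1).choose 4 : ℕ) : ℚ)) = 12767 / 4230 := by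
    norm_num [Finset.sum_range_succ, Nat.choose]
  rw [hsm, hsg, hs4m, hs4g]
  norm_num [Nat.choose] at h ⊢
  linarith

/-- **The cell `(15, 10)` by the nested dichotomy with the concentrated tail**: `RLS M 15 5` on every `e`-free core of rank `15` on `25`
points (standard caps `20 / 174 / 1518`, `phiK 15 5 ≤ 2^20/16173`; the cases `ν = 9, …, 4` on `≤ 14, …, 9` points each with its own
spanning count and slack, then spread with the kit's tail, slack `239/1024`). -/
theorem c025_core_five_fifteen_ten (M : Matroid α) [M.Finite]
    (hR : M.eRank = ((15 : ℕ) : ℕ∞)) (hn : M.E.ncard = 15 + 10)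
    (hfree : ∀ e ∈ M.E, ∃ A ⊆ M.E \ {e}, e ∉ M.closure A ∧ e ∉ M.closure ((M.E \ {e}) \ A)) :
    RLS M 15 5 := by
  classical
  have hd : M.E.encard = M.eRank + ((10 : ℕ) : ℕ∞) := by
    rw [hR, ← M.ground_finite.cast_ncard_eq, hn]
    push_cast
    ring
  obtain ⟨hs3, hs4, hs5⟩ := caps_fifteen_ten M hd hfree
  have full : ∀ (k : ℕ) {W : Set α}, W ⊆ M.E → W.encard = M.eRk W + k →
      Matroid.topCount M 15 5 ≤ ∑ m ∈ Finset.Icc 5 10, ∑ j ∈ Finset.Icc (m + k - 10) m,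
        W.ncard.choose j * (15 + 10 - W.ncard).choose (m - j) := by
    intro k W hW hWk
    refine (S2.topCount_le_sum_spanning M hR hd 5).trans ?_
    refine Finset.sum_le_sum (fun m _ => ?_)
    have h := S2.ncard_spanning_compl_le_of_nullity M hW hd hWk (m := m)
    rw [hn] at h
    exact h
  have span : ∀ (k : ℕ) {W : Set α}, W ⊆ M.E → W.encard = M.eRk W + k →
      {X : Set α | X ⊆ M.E ∧ M.eRk X = M.eRank}.ncard ≤ ∑ m ∈ Finset.range (10 + 1), ∑ j ∈ Finset.Icc (m + k - 10) m,
        W.ncard.choose j * (15 + 10 - W.ncard).choose (m - j) := by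
    intro k W hW hWk
    have h := S2.ncard_spanning_le_of_nullity M hW hd hWk
    rw [hn] at h
    exact h
  have cell : ∀ (U S m : ℕ), Matroid.topCount M 15 5 ≤ U → {X : Set α | X ⊆ M.E ∧ M.eRk X = M.eRank}.ncard ≤ S → m ≤ 1024 →
      1024 * (U : ℚ) ≤ ((1024 - m : ℕ) : ℚ) * 2 ^ (10 - 5) * (16173 : ℚ) →
      (1024 : ℚ) * ((3510681909905 / 5039622 : ℚ) + (S : ℚ)) ≤ (m : ℚ) * 2 ^ 25 → RLS M 15 5 := by
    intro U S m hU hS hm hpoly htail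
    rw [RLS_iff]
    exact c025_core_five_cell_of_topCount_spanning_xqictq5g M 15 10 (by norm_num) hR hn hfree 20 174 1518 hs3 hs4 hs5 U hU S hS
      16173 (by norm_num) (phiK 15 5) (by rw [S2.phiK_fifteen_five]; norm_num) ⟨m, hm, hpoly, tail_fifteen_ten S m htail⟩
  by_cases h9 : ∃ W ⊆ M.E, W.ncard ≤ 14 ∧ W.encard = M.eRk W + 9
  · obtain ⟨W, hW, hWn, hWk⟩ := h9
    have hU' : Matroid.topCount M 15 5 ≤ 173316 := by
      refine (full 9 hW hWk).trans ?_
      generalize W.ncard = w at hWn ⊢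
      interval_cases w <;> decide
    have hS' : {X : Set α | X ⊆ M.E ∧ M.eRk X = M.eRank}.ncard ≤ 179957 := by
      refine (span 9 hW hWk).trans ?_
      generalize W.ncard = w at hWn ⊢
      interval_cases w <;> decide
    exact cell 173316 179957 27 hU' hS' (by norm_num) (by norm_num) (by norm_num)
  by_cases h8 : ∃ W ⊆ M.E, W.ncard ≤ 13 ∧ W.encard = M.eRk W + 8
  · obtain ⟨W, hW, hWn, hWk⟩ := h8
    have hU := topCount_le_flat_count_two M 15 10 (by norm_num) hR hn hfree hW (by norm_num; exact hWk) hWn (by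
      rintro ⟨W', hW'E, hW'n, hW'k⟩
      exact h9 ⟨W', hW'E, by omega, by norm_num at hW'k; exact hW'k⟩)
    have hU' : Matroid.topCount M 15 5 ≤ 497825 := by
      generalize W.ncard = w at hWn hU
      rw [Finset.sum_Icc_succ_top (by norm_num : 5 ≤ 10), Finset.sum_Icc_succ_top (by norm_num : 5 ≤ 9), Finset.sum_Icc_succ_top (by norm_num : 5 ≤ 8), Finset.sum_Icc_succ_top (by norm_num : 5 ≤ 7), Finset.sum_Icc_succ_top (by norm_num : 5 ≤ 6), Finset.Icc_self, Finset.sum_singleton] at hU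
      interval_cases w <;> norm_num [Nat.choose] at hU <;>
        first
          | omega
          | (have hUq : (Matroid.topCount M 15 5 : ℚ) ≤ 497825 := by linarith
             exact_mod_cast hUq)
    have hS' : {X : Set α | X ⊆ M.E ∧ M.eRk X = M.eRank}.ncard ≤ 570402 := by
      refine (span 8 hW hWk).trans ?_
      generalize W.ncard = w at hWn ⊢
      interval_cases w <;> decide
    exact cell 497825 570402 39 hU' hS' (by norm_num) (by norm_num) (by norm_num)
  by_cases h7 : ∃ W ⊆ M.E, W.ncard ≤ 12 ∧ W.encard = M.eRk W + 7
  · obtain ⟨W, hW, hWn, hWk⟩ := h7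
    have hflat : ∀ X ⊆ M.E, M.eRk X ≤ 5 → X.ncard ≤ 12 := fun X hX hr => by
      have := S2.ncard_le_of_eRk_le_of_not_nullity M 8 13 (by norm_num) h8 hX (r := 5) (by norm_num) (by exact_mod_cast hr)
      omega
    have hflat' : ∀ X ⊆ M.E, M.eRk X ≤ 4 → X.ncard ≤ 10 := fun X hX hr =>
      ncard_le_ten_of_eRk_le_four_of_free M hfree hX hr
    have hV := S2.ncard_spanning_compl_le_of_nullity M hW hd hWk (m := 5)
    have hV' : ∑ j ∈ Finset.Icc (5 + 7 - 10) 5, W.ncard.choose j * (M.E.ncard - W.ncard).choose (5 - j) ≤ 43263 := by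
      rw [hn]
      generalize W.ncard = w at hWn ⊢
      interval_cases w <;> decide
    have hU := topCount_le_payment_flat M 15 10 (by norm_num) hR hn hfree 12 10 hflat hflat' (by norm_num) (by norm_num)
      20 174 1518 hs3 hs4 hs5 43263 (hV.trans hV')
    norm_num [Finset.sum_range_succ, Nat.choose] at hU
    have hUq : (Matroid.topCount M 15 5 : ℚ) ≤ 486706 := by linarith
    have hU' : Matroid.topCount M 15 5 ≤ 486706 := by exact_mod_cast hUq
    have hS' : {X : Set α | X ⊆ M.E ∧ M.eRk X = M.eRank}.ncard ≤ 1296842 := by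
      refine (span 7 hW hWk).trans ?_
      generalize W.ncard = w at hWn ⊢
      interval_cases w <;> decide
    exact cell 486706 1296842 61 hU' hS' (by norm_num) (by norm_num) (by norm_num)
  by_cases h6 : ∃ W ⊆ M.E, W.ncard ≤ 11 ∧ W.encard = M.eRk W + 6
  · obtain ⟨W, hW, hWn, hWk⟩ := h6
    have hflat : ∀ X ⊆ M.E, M.eRk X ≤ 5 → X.ncard ≤ 11 := fun X hX hr => by
      have := S2.ncard_le_of_eRk_le_of_not_nullity M 7 12 (by norm_num) h7 hX (r := 5) (by norm_num) (by exact_mod_cast hr)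
      omega
    have hflat' : ∀ X ⊆ M.E, M.eRk X ≤ 4 → X.ncard ≤ 10 := fun X hX hr =>
      ncard_le_ten_of_eRk_le_four_of_free M hfree hX hr
    have hV := S2.ncard_spanning_compl_le_of_nullity M hW hd hWk (m := 5)
    have hV' : ∑ j ∈ Finset.Icc (5 + 6 - 10) 5, W.ncard.choose j * (M.E.ncard - W.ncard).choose (5 - j) ≤ 51128 := by
      rw [hn]
      generalize W.ncard = w at hWn ⊢
      interval_cases w <;> decide
    have hU := topCount_le_payment_flat M 15 10 (by norm_num) hR hn hfree 11 10 hflat hflat' (by norm_num) (by norm_num)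
      20 174 1518 hs3 hs4 hs5 51128 (hV.trans hV')
    norm_num [Finset.sum_range_succ, Nat.choose] at hU
    have hUq : (Matroid.topCount M 15 5 : ℚ) ≤ 470027 := by linarith
    have hU' : Matroid.topCount M 15 5 ≤ 470027 := by exact_mod_cast hUq
    have hS' : {X : Set α | X ⊆ M.E ∧ M.eRk X = M.eRank}.ncard ≤ 2359332 := by
      refine (span 6 hW hWk).trans ?_
      generalize W.ncard = w at hWn ⊢
      interval_cases w <;> decide
    exact cell 470027 2359332 94 hU' hS' (by norm_num) (by norm_num) (by norm_num)
  by_cases h5 : ∃ W ⊆ M.E, W.ncard ≤ 10 ∧ W.encard = M.eRk W + 5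
  · obtain ⟨W, hW, hWn, hWk⟩ := h5
    have hflat : ∀ X ⊆ M.E, M.eRk X ≤ 5 → X.ncard ≤ 10 := fun X hX hr => by
      have := S2.ncard_le_of_eRk_le_of_not_nullity M 6 11 (by norm_num) h6 hX (r := 5) (by norm_num) (by exact_mod_cast hr)
      omega
    have hflat' : ∀ X ⊆ M.E, M.eRk X ≤ 4 → X.ncard ≤ 9 := fun X hX hr => by
      have := S2.ncard_le_of_eRk_le_of_not_nullity M 6 11 (by norm_num) h6 hX (r := 4) (by norm_num) (by exact_mod_cast hr)
      omega
    have hV := S2.ncard_spanning_compl_le_of_nullity M hW hd hWk (m := 5)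
    have hV' : ∑ j ∈ Finset.Icc (5 + 5 - 10) 5, W.ncard.choose j * (M.E.ncard - W.ncard).choose (5 - j) ≤ 53130 := by
      rw [hn]
      generalize W.ncard = w at hWn ⊢
      interval_cases w <;> decide
    have hU := topCount_le_payment_flat M 15 10 (by norm_num) hR hn hfree 10 9 hflat hflat' (by norm_num) (by norm_num)
      20 174 1518 hs3 hs4 hs5 53130 (hV.trans hV')
    norm_num [Finset.sum_range_succ, Nat.choose] at hU
    have hUq : (Matroid.topCount M 15 5 : ℚ) ≤ 450316 := by linarith
    have hU' : Matroid.topCount M 15 5 ≤ 450316 := by exact_mod_cast hUq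
    have hS' : {X : Set α | X ⊆ M.E ∧ M.eRk X = M.eRank}.ncard ≤ 3636608 := by
      refine (span 5 hW hWk).trans ?_
      generalize W.ncard = w at hWn ⊢
      interval_cases w <;> decide
    exact cell 450316 3636608 133 hU' hS' (by norm_num) (by norm_num) (by norm_num)
  by_cases h4 : ∃ W ⊆ M.E, W.ncard ≤ 9 ∧ W.encard = M.eRk W + 4
  · obtain ⟨W, hW, hWn, hWk⟩ := h4
    have hflat : ∀ X ⊆ M.E, M.eRk X ≤ 5 → X.ncard ≤ 9 := fun X hX hr => by
      have := S2.ncard_le_of_eRk_le_of_not_nullity M 5 10 (by norm_num) h5 hX (r := 5) (by norm_num) (by exact_mod_cast hr)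
      omega
    have hflat' : ∀ X ⊆ M.E, M.eRk X ≤ 4 → X.ncard ≤ 8 := fun X hX hr => by
      have := S2.ncard_le_of_eRk_le_of_not_nullity M 5 10 (by norm_num) h5 hX (r := 4) (by norm_num) (by exact_mod_cast hr)
      omega
    have hV := S2.ncard_spanning_compl_le_of_nullity M hW hd hWk (m := 5)
    have hV' : ∑ j ∈ Finset.Icc (5 + 4 - 10) 5, W.ncard.choose j * (M.E.ncard - W.ncard).choose (5 - j) ≤ 53130 := by
      rw [hn]
      generalize W.ncard = w at hWn ⊢
      interval_cases w <;> decide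
    have hU := topCount_le_payment_flat M 15 10 (by norm_num) hR hn hfree 9 8 hflat hflat' (by norm_num) (by norm_num)
      20 174 1518 hs3 hs4 hs5 53130 (hV.trans hV')
    norm_num [Finset.sum_range_succ, Nat.choose] at hU
    have hUq : (Matroid.topCount M 15 5 : ℚ) ≤ 430606 := by linarith
    have hU' : Matroid.topCount M 15 5 ≤ 430606 := by exact_mod_cast hUq
    have hS' : {X : Set α | X ⊆ M.E ∧ M.eRk X = M.eRank}.ncard ≤ 4917888 := by
      refine (span 4 hW hWk).trans ?_
      generalize W.ncard = w at hWn ⊢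
      interval_cases w <;> decide
    exact cell 430606 4917888 172 hU' hS' (by norm_num) (by norm_num) (by norm_num)
  · -- spread: rank-`5` sets `≤ 8`, rank-`4` sets `≤ 7`; the kit's spanning bound `Σ_{j ≤ 10} C(25, j) = 7119516`
    have hflat : ∀ X ⊆ M.E, M.eRk X ≤ 5 → X.ncard ≤ 8 := fun X hX hr => by
      have := S2.ncard_le_of_eRk_le_of_not_nullity M 4 9 (by norm_num) h4 hX (r := 5) (by norm_num) (by exact_mod_cast hr)
      omega
    have hflat' : ∀ X ⊆ M.E, M.eRk X ≤ 4 → X.ncard ≤ 7 := fun X hX hr => by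
      have := S2.ncard_le_of_eRk_le_of_not_nullity M 4 9 (by norm_num) h4 hX (r := 4) (by norm_num) (by exact_mod_cast hr)
      omega
    have hU := topCount_le_flat M 15 10 (by norm_num) hR hn hfree 8 7 hflat hflat' (by norm_num) (by norm_num)
      20 174 1518 hs3 hs4 hs5
    norm_num [Finset.sum_range_succ, Nat.choose] at hU
    have hU' : Matroid.topCount M 15 5 ≤ 396743 := hU.trans (by norm_num)
    have hEcard : M.ground_finite.toFinset.card = 15 + 10 := by
      rw [← Set.ncard_eq_toFinset_card _ M.ground_finite]; exact hn
    have hS := Matroid.ncard_spanning_le (M := M) hd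
    rw [hEcard] at hS
    have hS' : {X : Set α | X ⊆ M.E ∧ M.eRk X = M.eRank}.ncard ≤ 7119516 := hS.trans (by decide)
    exact cell 396743 7119516 239 hU' hS' (by norm_num) (by norm_num) (by norm_num)
end ThmN

end PercRepro
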